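import Mathlib
import Literature.Probability.Percolation.CriticalContinuity
import Literature.Probability.Percolation.TwoPointFunction

/-!
# Sketch — first lemmas for the crux ideas on `PercTreeValue.TetrahedronLogConvexity`
(stmt-CriticalPhenomena-7801; ideator 1, round 1).  Statements only (Props); nothing is proved here.

Geometry: `T_r = {0, a_r, b_r, c_r}`, `a_r = (r,r,0)`, `b_r = (r,0,r)`, `c_r = (0,r,r)`; `σ = (x₁ ↔ x₂)` fixes
`0, a_r` and swaps `b_r, c_r`.  `μ_p = bondPercolation (zdGraph 3) p`.
-/

namespace Summit.CriticalPhenomena.PercolationContinuityZ3.Cruxes.TetrahedronLogConvexity.Sketch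

open MeasureTheory Filter Literature.Probability.Percolation Literature.Probability.LatticeModels

noncomputable section

/-- `a_r = (r,r,0)`. -/
def va (r : ℕ) : Site 3 := ![(r : ℤ), (r : ℤ), 0]
/-- `b_r = (r,0,r)`. -/
def vb (r : ℕ) : Site 3 := ![(r : ℤ), 0, (r : ℤ)]
/-- `c_r = (0,r,r)`. -/
def vc (r : ℕ) : Site 3 := ![0, (r : ℤ), (r : ℤ)]
/-- The fourth point moved along the symmetry ray of the face `{0, a_r, b_r}` (for `r = 3s`):
`c'_k = g + k(-1,1,1)`, `g = (2s, s, s)` the centroid; `k = 2s` is `c_r`. -/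
def axisPt (s k : ℕ) : Site 3 := ![(2 * s : ℤ) - k, (s : ℤ) + k, (s : ℤ) + k]

/-- Edges of `ℤ³` with both endpoints at height `≤ m` (everything strictly below the plane `x₃ = m + 1`). -/
def lowEdges (m : ℤ) : Set (Sym2 (Site 3)) := {e | ∀ x ∈ e, x 2 ≤ m}

/-- Gluing map of the replica construction: `ω₁` on the low edges, `ω₂` elsewhere. Under `μ ⊗ μ` the glued
configuration has law `μ`; `glue m ω₁ ω₂` and `glue m ω₁ ω₃` share the low part and are conditionally independent. -/
def glue (m : ℤ) (ω₁ ω₂ : BondConfig (Site 3)) : BondConfig (Site 3) :=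
  (ω₁ ∩ lowEdges m) ∪ (ω₂ \ lowEdges m)

/-- `{0 ↔ a_r below height m}`: connection inside the vertex region `{x₃ ≤ m}` (monotone in `m`; empty for `m < 0`). -/
def connBelow (m : ℤ) (r : ℕ) : Set (BondConfig (Site 3)) :=
  openConnIn {x : Site 3 | x 2 ≤ m} 0 (va r)

/-- Certification height `ρ* = m`: `0 ↔ a_r` below height `m` but not below height `m - 1` (a stopping event of the
height filtration; `⋃ₘ certAt m r = {0 ↔ a_r}` since every open path is finite). -/
def certAt (m : ℕ) (r : ℕ) : Set (BondConfig (Site 3)) :=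
  connBelow (m : ℤ) r \ connBelow ((m : ℤ) - 1) r

/-- CARD A, first lemma (fixed region; exact, every `p, r, m`): **Harris in the fibres, replica form.**
Given the configuration below height `m`, the captures `{0 ↔ b_r}`, `{0 ↔ c_r}` are increasing in the fresh upper edges,
so on `{0 ↔ a_r below m}` their conditional probabilities multiply below the conditional probability of the joint capture.
Written without conditional expectations through two replicas glued below height `m`. -/
def ReplicaHarrisBelow : Prop :=
  ∀ (p : unitInterval) (r : ℕ) (m : ℤ),
    ((bondPercolation (zdGraph 3) p).prod ((bondPercolation (zdGraph 3) p).prod (bondPercolation (zdGraph 3) p))).real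
        {q | glue m q.1 q.2.1 ∈ connBelow m r ∩ openConn 0 (vb r) ∧ glue m q.1 q.2.2 ∈ openConn 0 (vc r)}
      ≤ (bondPercolation (zdGraph 3) p).real (connBelow m r ∩ openConn 0 (vb r) ∩ openConn 0 (vc r))

/-- CARD A, the loss-free backbone (exact, every `p, r`): summing the fibre-Harris inequality over the certification height
`ρ* = m` loses nothing, because `{0 ↔ a_r} = ⋃ₘ {ρ* = m}` disjointly.  Left side = `E[1_{0↔a} h_b h_c]` with
`h_• = P(0 ↔ • | 𝓕_{ρ*})`; the matching identity `P(0 ↔ a_r ↔ b_r) = Σₘ (μ⊗μ){ρ*(glue) = m, glue ∈ {0↔b_r}}` is bookkeeping. -/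
def LossFreeReplicaBackbone : Prop :=
  ∀ (p : unitInterval) (r : ℕ),
    (∑' m : ℕ, ((bondPercolation (zdGraph 3) p).prod
        ((bondPercolation (zdGraph 3) p).prod (bondPercolation (zdGraph 3) p))).real
          {q | glue m q.1 q.2.1 ∈ certAt m r ∩ openConn 0 (vb r) ∧ glue m q.1 q.2.2 ∈ openConn 0 (vc r)})
      ≤ (bondPercolation (zdGraph 3) p).real (openConn 0 (va r) ∩ openConn 0 (vb r) ∩ openConn 0 (vc r))

/-- CARD A, sub-claim (C) PROPENSITY COVARIANCE NON-NEGATIVE ("size beats lean"; MC at r = 6: Cov_Q(h_b,h_c) =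
+0.076(15)·(E_Q h)², i.e. Var_Q h₊ = 0.484 vs E_Q h₋² = 0.408 in units of (E_Q h)²): `E_Q[h_b h_c] ≥ E_Q h_b · E_Q h_c`,
division-free in replica form, `E[1_A h_b h_c] · P(A) ≥ E[1_A h_b] · E[1_A h_c]` with `A = {0 ↔ a_r}`. With it,
`Φ ≥ 1 + (fibre Harris excess)/(E_Q h)²`, so the crux follows from (C) ∧ (H). -/
def PropensityCovNonneg : Prop :=
  ∃ r₀ : ℕ, ∀ r : ℕ, r₀ ≤ r →
    (bondPercolation (zdGraph 3) (criticalProbI 3)).real (openConn 0 (va r) ∩ openConn 0 (vb r))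
        * (bondPercolation (zdGraph 3) (criticalProbI 3)).real (openConn 0 (va r) ∩ openConn 0 (vc r))
      ≤ (∑' m : ℕ, ((bondPercolation (zdGraph 3) (criticalProbI 3)).prod
            ((bondPercolation (zdGraph 3) (criticalProbI 3)).prod (bondPercolation (zdGraph 3) (criticalProbI 3)))).real
            {q | glue m q.1 q.2.1 ∈ certAt m r ∩ openConn 0 (vb r) ∧ glue m q.1 q.2.2 ∈ openConn 0 (vc r)})
        * tau 3 (criticalProbI 3) 0 (va r)

/-- CARD A, sub-claim (H) QUANTIFIED FIBRE-HARRIS EXCESS (up to constants; fails in every jump world; MC at r = 6: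
0.137·(E_Q h)², 65 % of Φ−1): the Q-average of the within-fibre FKG covariance of the two captures through the FRESH edges
above the certification height is a fixed fraction of (E_Q h)²: `E[1_A (h_bc − h_b h_c)] ≥ δ_H · P(0ab)²/P(0a)`, replica form
(same-replica joint capture minus cross-replica joint capture, summed over the certification height). -/
def FibreHarrisExcess : Prop :=
  ∃ δH : ℝ, 0 < δH ∧ ∃ r₀ : ℕ, ∀ r : ℕ, r₀ ≤ r →
    δH * (bondPercolation (zdGraph 3) (criticalProbI 3)).real (openConn 0 (va r) ∩ openConn 0 (vb r)) ^ 2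
        / tau 3 (criticalProbI 3) 0 (va r)
      ≤ (bondPercolation (zdGraph 3) (criticalProbI 3)).real (openConn 0 (va r) ∩ openConn 0 (vb r) ∩ openConn 0 (vc r))
        - ∑' m : ℕ, ((bondPercolation (zdGraph 3) (criticalProbI 3)).prod
            ((bondPercolation (zdGraph 3) (criticalProbI 3)).prod (bondPercolation (zdGraph 3) (criticalProbI 3)))).real
            {q | glue m q.1 q.2.1 ∈ certAt m r ∩ openConn 0 (vb r) ∧ glue m q.1 q.2.2 ∈ openConn 0 (vc r)}

/-- CARD A, target sub-claim (S) SIZE MODULATION at `p_c` (up-to-constants; fails in every jump world): the capture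
propensity averaged over the certification fibre, `m(ρ) = E[h_b | ρ* = ρ, 0↔a]`, is not asymptotically constant in `ρ`:
its `Q`-variance is a fixed fraction of its squared mean.  Division-free form with the replica measures
(`Var_Q m(ρ*) · Q-normalisation ≥ δ₁ (E_Q h)²`): `Σₘ P(ρ*=m) · [P(ρ*=m, 0↔b)/P(ρ*=m)]² ≥ (1+δ₁) P(0↔a↔b)² / P(0↔a)`. -/
def SizeModulation : Prop :=
  ∃ δ₁ : ℝ, 0 < δ₁ ∧ ∃ r₀ : ℕ, ∀ r : ℕ, r₀ ≤ r →
    (1 + δ₁) * (bondPercolation (zdGraph 3) (criticalProbI 3)).real (openConn 0 (va r) ∩ openConn 0 (vb r)) ^ 2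
        / (bondPercolation (zdGraph 3) (criticalProbI 3)).real (openConn 0 (va r))
      ≤ ∑' m : ℕ, (bondPercolation (zdGraph 3) (criticalProbI 3)).real (certAt m r ∩ openConn 0 (vb r)) ^ 2
          / (bondPercolation (zdGraph 3) (criticalProbI 3)).real (certAt m r)

/-- CARD B, sub-claim (M) MONOTONE FADE along the symmetry ray (for `r = 3s`, beyond the tetrahedral position `k = 2s`):
the capture ratio `Φ(k) = P(c'_k ∈ C | 0,a,b ∈ C) / P(c'_k ∈ C | 0,a ∈ C)` is non-increasing in `k`, division-free. -/
def AxisMonotoneFade : Prop :=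
  ∃ s₀ : ℕ, ∀ s : ℕ, s₀ ≤ s → ∀ k : ℕ, 2 * s ≤ k →
    (bondPercolation (zdGraph 3) (criticalProbI 3)).real
        (openConn 0 (va (3 * s)) ∩ openConn 0 (vb (3 * s)) ∩ openConn 0 (axisPt s (k + 1)))
      * (bondPercolation (zdGraph 3) (criticalProbI 3)).real (openConn 0 (va (3 * s)) ∩ openConn 0 (axisPt s k))
    ≤ (bondPercolation (zdGraph 3) (criticalProbI 3)).real
        (openConn 0 (va (3 * s)) ∩ openConn 0 (vb (3 * s)) ∩ openConn 0 (axisPt s k))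
      * (bondPercolation (zdGraph 3) (criticalProbI 3)).real (openConn 0 (va (3 * s)) ∩ openConn 0 (axisPt s (k + 1)))

/-- CARD B, robust variant of (M)+(F) in one statement (AXIS RIGIDITY with slack): the capture ratio never rises by
more than `η` beyond the tetrahedral position, and its far-field liminf exceeds `1 + δ` with `δ > η`; then
`Φ(c_r) ≥ 1 + (δ - η)`.  (MC: the axis profile varies by ≤ 0.012 while δ ≈ 0.17.) -/
def AxisRigidFarField : Prop :=
  ∃ δ η : ℝ, 0 ≤ η ∧ η < δ ∧ ∃ s₀ : ℕ, ∀ s : ℕ, s₀ ≤ s →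
    (∀ k : ℕ, 2 * s ≤ k →
      (bondPercolation (zdGraph 3) (criticalProbI 3)).real
          (openConn 0 (va (3 * s)) ∩ openConn 0 (vb (3 * s)) ∩ openConn 0 (axisPt s k))
        * (bondPercolation (zdGraph 3) (criticalProbI 3)).real (openConn 0 (va (3 * s)) ∩ openConn 0 (axisPt s (2 * s)))
      ≤ ((bondPercolation (zdGraph 3) (criticalProbI 3)).real
          (openConn 0 (va (3 * s)) ∩ openConn 0 (vb (3 * s)) ∩ openConn 0 (axisPt s (2 * s)))
          + η * ((bondPercolation (zdGraph 3) (criticalProbI 3)).real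
              (openConn 0 (va (3 * s)) ∩ openConn 0 (vb (3 * s))) *
            (bondPercolation (zdGraph 3) (criticalProbI 3)).real (openConn 0 (va (3 * s)) ∩ openConn 0 (axisPt s (2 * s)))
              / tau 3 (criticalProbI 3) 0 (va (3 * s))))
        * (bondPercolation (zdGraph 3) (criticalProbI 3)).real (openConn 0 (va (3 * s)) ∩ openConn 0 (axisPt s k))) ∧
    1 + δ ≤ Filter.liminf (fun k : ℕ =>
      (bondPercolation (zdGraph 3) (criticalProbI 3)).real
          (openConn 0 (va (3 * s)) ∩ openConn 0 (vb (3 * s)) ∩ openConn 0 (axisPt s k))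
        * tau 3 (criticalProbI 3) 0 (va (3 * s))
        / ((bondPercolation (zdGraph 3) (criticalProbI 3)).real (openConn 0 (va (3 * s)) ∩ openConn 0 (vb (3 * s)))
          * (bondPercolation (zdGraph 3) (criticalProbI 3)).real (openConn 0 (va (3 * s)) ∩ openConn 0 (axisPt s k))))
      Filter.atTop

/-- CARD B, sub-claim (F) FAR-FIELD SIZE BIAS (lean-free by monopole dominance; fails in every jump world): sending the
fourth point to infinity along the ray, the capture ratio stays `≥ 1 + δ` uniformly in `r = 3s`. -/
def FarFieldSizeBias : Prop :=
  ∃ δ : ℝ, 0 < δ ∧ ∃ s₀ : ℕ, ∀ s : ℕ, s₀ ≤ s →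
    1 + δ ≤ Filter.liminf (fun k : ℕ =>
      (bondPercolation (zdGraph 3) (criticalProbI 3)).real
          (openConn 0 (va (3 * s)) ∩ openConn 0 (vb (3 * s)) ∩ openConn 0 (axisPt s k))
        * tau 3 (criticalProbI 3) 0 (va (3 * s))
        / ((bondPercolation (zdGraph 3) (criticalProbI 3)).real (openConn 0 (va (3 * s)) ∩ openConn 0 (vb (3 * s)))
          * (bondPercolation (zdGraph 3) (criticalProbI 3)).real (openConn 0 (va (3 * s)) ∩ openConn 0 (axisPt s k))))
      Filter.atTop

/-- CARD B, the lean-free ESCAPE form of (F) (what (F) reduces to under far-field factorisation): the crux with the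
fourth vertex replaced by the σ-symmetric escape event `{0 ↔ ∂B(R)}`, `R → ∞` after `r → ∞`:
`Q(0 ↔ ∂B_R | b_r ∈ C) ≥ (1+δ) Q(0 ↔ ∂B_R)`, `Q = P(· | 0 ↔ a_r)` — among clusters pinned at `0, a_r`, those that also
capture `b_r` escape to scale `R` more easily, by a constant FACTOR (both sides → 0 as `R → ∞` in the continuous world,
→ 1 in a jump world, where the inequality fails as it must). -/
def EscapeSizeBias : Prop :=
  ∃ δ : ℝ, 0 < δ ∧ ∃ r₀ : ℕ, ∀ r : ℕ, r₀ ≤ r → ∃ R₀ : ℕ, ∀ R : ℕ, R₀ ≤ R →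
    (1 + δ) * (bondPercolation (zdGraph 3) (criticalProbI 3)).real (openConn 0 (va r) ∩ openConn 0 (vb r))
        * (bondPercolation (zdGraph 3) (criticalProbI 3)).real (openConn 0 (va r) ∩ siteToBoundary 3 R)
      ≤ (bondPercolation (zdGraph 3) (criticalProbI 3)).real (openConn 0 (va r) ∩ openConn 0 (vb r) ∩ siteToBoundary 3 R)
        * tau 3 (criticalProbI 3) 0 (va r)

/-- Bookkeeping used by both cards (exact, every graph, every `p`): the odds-ratio form of the crux numerator. -/
def OddsRatioIdentity : Prop :=
  ∀ (p : unitInterval) (r : ℕ),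
    let μ := bondPercolation (zdGraph 3) p
    let A := openConn (0 : Site 3) (va r); let B := openConn (0 : Site 3) (vb r); let C := openConn (0 : Site 3) (vc r)
    μ.real (A ∩ B ∩ C) * μ.real A - μ.real (A ∩ B) * μ.real (A ∩ C)
      = μ.real (A ∩ B ∩ C) * μ.real (A ∩ Bᶜ ∩ Cᶜ) - μ.real (A ∩ B ∩ Cᶜ) * μ.real (A ∩ Bᶜ ∩ C)

end

end Summit.CriticalPhenomena.PercolationContinuityZ3.Cruxes.TetrahedronLogConvexity.Sketch
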